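import Summits.CriticalPhenomena.Ising3DConformalLimit.Theorems.InverseSquareTelemetryEtaBoundsFromTelemetryPowers
import Literature.Probability.LatticeModels.CorrelationDecayProofs
import Summits.CriticalPhenomena.Ising3DConformalLimit.Theorems.PerfectScreeningScreeningDichotomyGreen
import HarnessLib

/-!
# Route `InverseSquareTelemetry`, item `EtaBoundsFromTelemetry` (stmt-CriticalPhenomena-4499),
# helper file 2: barrier arithmetic, the weight `h = s^{-1/4}`, and bookkeeping on `ℤ³`

THEOREM-ONLY file (no definitions, no named facts), `--supports stmt-CriticalPhenomena-4499`.

Let `V : ℤ³ → ℝ` satisfy the inverse-square telemetry bound `|s(x) V(x) - κ| ≤ C s(x)^{-e}`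
(`κ ≥ 0`, `e > 0`, `s(x) = ∑ᵢ xᵢ²`), let `2p(2p - 1) = κ` with `p ≥ 1/2` (so `2p = α₊(κ)` is the
decaying indicial root) and `0 < e' < e`, `e' ≤ 1/8`. With the lattice Taylor expansion of
`…Powers.lean` (`|Δ s^{-p} - 2p(2p-1)s^{-p-1}| ≤ K s^{-p-3/2}`), the pointwise real arithmetic proved
here shows that far out

* `w₊ = s^{-p} - A s^{-p-e'}` is a supersolution and `w₋ = s^{-p} + A s^{-p-e'}` a subsolution of
  `Δ - V` (`barrier_arith`: `Δ w₊ ≤ V w₊`, `V w₋ ≤ Δ w₋`), once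
  `K_p s^{e'-1/2} + A K_q s^{-1/2} + C s^{e'-e} + C A s^{-e} ≤ A D`, `D = 2q(2q-1) - κ`, `q = p + e'`;
* `h = s^{-1/4}` is a positive supersolution, `Δ h ≤ V h` (`weight_arith`; `1/4 ∈ (α₋/2, α₊/2)`:
  `2·(1/4)·(2·(1/4) - 1) = -1/4 < 0 ≤ κ`), the weight of the `h`-transform maximum principle;

and records the bookkeeping used by the comparison argument (`…Exterior.lean`): `s(x) → ∞`
cofinitely, finite sublevel sets `{s ≤ S}`, thresholds from `s^{-c} → 0`, ratio bounds on finite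
sets, the shell `∂{S₀ ≤ s} ⊆ {S₀/4 ≤ s < S₀}`, the norm exchange `‖x‖⁻¹ ≤ √3 s^{-1/2}`, and
linearity of `Δ` in the lambda form.
-/

noncomputable section

namespace Summit.CriticalPhenomena.Ising3DConformalLimit.Theorems.EtaBoundsFromTelemetry

open Literature.Probability.LatticeModels Finset Set Filter Topology

/-! ### Pointwise arithmetic of the barriers -/

/-- **Barrier arithmetic** at one point. With `Q₁ = s^{-q-1}`, `q = p + e'`, all powers of `s`
are multiples of `Q₁`; the telemetry bound `|sV - κ| ≤ C s^{-e}`, the Laplacian expansions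
`|L_p - κ s^{-p-1}| ≤ K_p s^{-p-3/2}`, `|L_q - (κ + D) s^{-q-1}| ≤ K_q s^{-q-3/2}` and the smallness
`K_p s^{e'-1/2} + A K_q s^{-1/2} + C s^{e'-e} + C A s^{-e} ≤ A D` give
`L_p - A L_q ≤ V (s^{-p} - A s^{-q})` and `V (s^{-p} + A s^{-q}) ≤ L_p + A L_q`. [folklore] -/
theorem barrier_arith {s p e e' κ C A D Kp Kq Lp Lq V : ℝ} (hs : 1 ≤ s) (hA : 0 ≤ A)
    (hC : 0 ≤ C) (hu : A ≤ s ^ e')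
    (hLp : |Lp - κ * s ^ (-p - 1)| ≤ Kp * s ^ (-p - 3 / 2))
    (hLq : |Lq - (κ + D) * s ^ (-(p + e') - 1)| ≤ Kq * s ^ (-(p + e') - 3 / 2))
    (hV : |s * V - κ| ≤ C * s ^ (-e))
    (hsmall : Kp * s ^ (e' - 1 / 2) + A * Kq * s ^ (-(1 / 2 : ℝ)) + C * s ^ (e' - e) +
      C * A * s ^ (-e) ≤ A * D) :
    Lp - A * Lq ≤ V * (s ^ (-p) - A * s ^ (-(p + e'))) ∧
      V * (s ^ (-p) + A * s ^ (-(p + e'))) ≤ Lp + A * Lq := by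
  have s0 : 0 < s := by linarith
  have hpow : ∀ a b : ℝ, s ^ a * s ^ b = s ^ (a + b) := fun a b => (Real.rpow_add s0 a b).symm
  -- every power is a multiple of `Q₁ = s^{-q-1}`
  set Q : ℝ := s ^ (-(p + e') - 1) with hQ
  set u : ℝ := s ^ e' with hu'
  set v1 : ℝ := s ^ (e' - 1 / 2) with hv1
  set v2 : ℝ := s ^ (-(1 / 2 : ℝ)) with hv2
  set σ : ℝ := s ^ (-e) with hσ
  set τ : ℝ := s ^ (e' - e) with hτ
  have hQ0 : 0 < Q := Real.rpow_pos_of_pos s0 _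
  have hσ0 : 0 ≤ σ := Real.rpow_nonneg s0.le _
  have e1 : s ^ (-p - 1) = u * Q := by rw [hu', hQ, hpow]; congr 1; ring
  have e2 : s ^ (-p - 3 / 2) = v1 * Q := by rw [hv1, hQ, hpow]; congr 1; ring
  have e3 : s ^ (-(p + e') - 3 / 2) = v2 * Q := by rw [hv2, hQ, hpow]; congr 1; ring
  have e4 : s ^ (-p) = s * (u * Q) := by
    calc s ^ (-p) = s ^ ((1 : ℝ) + (-p - 1)) := by congr 1; ring
      _ = s ^ (1 : ℝ) * s ^ (-p - 1) := Real.rpow_add s0 _ _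
      _ = s * (u * Q) := by rw [Real.rpow_one, e1]
  have e5 : s ^ (-(p + e')) = s * Q := by
    calc s ^ (-(p + e')) = s ^ ((1 : ℝ) + (-(p + e') - 1)) := by congr 1; ring
      _ = s ^ (1 : ℝ) * s ^ (-(p + e') - 1) := Real.rpow_add s0 _ _
      _ = s * Q := by rw [Real.rpow_one]
  have e6 : σ * u = τ := by rw [hσ, hu', hτ, hpow]; congr 1; ring
  rw [e1, e2] at hLp
  rw [e3] at hLq
  rw [e4, e5]
  rw [← e6] at hsmall
  -- the telemetry bound on `W = s V`
  obtain ⟨hW1, hW2⟩ := abs_le.1 hV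
  obtain ⟨hLp1, hLp2⟩ := abs_le.1 hLp
  obtain ⟨hLq1, hLq2⟩ := abs_le.1 hLq
  have huA : 0 ≤ u - A := sub_nonneg.2 hu
  have hu0 : 0 ≤ u := hA.trans hu
  -- products of signed quantities, pre-multiplied for `linarith`
  have f1 : 0 ≤ (s * V - κ + C * σ) * (Q * (u - A)) := mul_nonneg (by linarith) (by positivity)
  have f2 : 0 ≤ (κ + C * σ - s * V) * (Q * (u + A)) := mul_nonneg (by linarith) (by positivity)
  have f3 : A * ((κ + D) * Q - Kq * (v2 * Q)) ≤ A * Lq := mul_le_mul_of_nonneg_left (by linarith) hA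
  have f5 : Q * (Kp * v1 + A * Kq * v2 + C * (σ * u) + C * A * σ) ≤ Q * (A * D) :=
    mul_le_mul_of_nonneg_left hsmall hQ0.le
  have f6 : 0 ≤ C * σ * A * Q := by positivity
  constructor
  · linarith [f1, f3, f5, f6]
  · linarith [f2, f3, f5]

/-- **Weight arithmetic** at one point: with `|L_h + (1/4) s^{-5/4}| ≤ K_h s^{-7/4}` (the expansion of
`Δ s^{-1/4}`, `2·(1/4)·(2·(1/4)-1) = -1/4`), `|sV - κ| ≤ C s^{-e}`, `κ ≥ 0` and the smallness
`K_h s^{-1/2} + C s^{-e} ≤ 1/4`, one has `L_h ≤ V s^{-1/4}`. [folklore] -/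
theorem weight_arith {s e κ C Kh Lh V : ℝ} (hs : 1 ≤ s) (hκ : 0 ≤ κ)
    (hLh : |Lh - 2 * (1 / 4 : ℝ) * (2 * (1 / 4 : ℝ) - 1) * s ^ (-(1 / 4 : ℝ) - 1)| ≤
      Kh * s ^ (-(1 / 4 : ℝ) - 3 / 2))
    (hV : |s * V - κ| ≤ C * s ^ (-e))
    (hsmall : Kh * s ^ (-(1 / 2 : ℝ)) + C * s ^ (-e) ≤ 1 / 4) :
    Lh ≤ V * s ^ (-(1 / 4 : ℝ)) := by
  have s0 : 0 < s := by linarith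
  have hpow : ∀ a b : ℝ, s ^ a * s ^ b = s ^ (a + b) := fun a b => (Real.rpow_add s0 a b).symm
  set H : ℝ := s ^ (-(1 / 4 : ℝ) - 1) with hH
  set v2 : ℝ := s ^ (-(1 / 2 : ℝ)) with hv2
  set σ : ℝ := s ^ (-e) with hσ
  have hH0 : 0 < H := Real.rpow_pos_of_pos s0 _
  have e2 : s ^ (-(1 / 4 : ℝ) - 3 / 2) = v2 * H := by rw [hv2, hH, hpow]; congr 1; ring
  have e4 : s ^ (-(1 / 4 : ℝ)) = s * H := by
    calc s ^ (-(1 / 4 : ℝ)) = s ^ ((1 : ℝ) + (-(1 / 4 : ℝ) - 1)) := by norm_num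
      _ = s ^ (1 : ℝ) * s ^ (-(1 / 4 : ℝ) - 1) := Real.rpow_add s0 _ _
      _ = s * H := by rw [Real.rpow_one]
  rw [e2] at hLh
  rw [e4]
  obtain ⟨hW1, hW2⟩ := abs_le.1 hV
  obtain ⟨hL1, hL2⟩ := abs_le.1 hLh
  have f1 : (κ - C * σ) * H ≤ s * V * H := mul_le_mul_of_nonneg_right (by linarith) hH0.le
  have f2 : H * (Kh * v2 + C * σ) ≤ H * (1 / 4) := mul_le_mul_of_nonneg_left hsmall hH0.le
  have f3 : 0 ≤ κ * H := mul_nonneg hκ hH0.le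
  linarith [f1, f2, f3, hL2]

/-! ### Bookkeeping on `ℤ³`: `s(x) → ∞`, finite sublevel sets, thresholds -/

/-- `s(x) = ∑ᵢ xᵢ² → ∞` along the cofinite filter of `ℤ³` (`‖x‖² ≤ s(x)` and `‖x‖ → ∞`). [folklore] -/
theorem tendsto_sumSq_cofinite :
    Tendsto (fun x : Site 3 => ∑ i, ((x i : ℤ) : ℝ) ^ 2) cofinite atTop := by
  refine tendsto_atTop_mono (fun x => ?_)
    ((tendsto_pow_atTop two_ne_zero).comp Site.tendsto_norm_cofinite_atTop)
  exact (Real.le_sqrt (norm_nonneg _) (by positivity)).1 (PerfectScreening.norm_le_sqrt_sum_sq x)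

/-- Sublevel sets of `s` are finite. [folklore] -/
theorem finite_sumSq_le (S : ℝ) : {x : Site 3 | ∑ i, ((x i : ℤ) : ℝ) ^ 2 ≤ S}.Finite := by
  have h := Filter.eventually_cofinite.1 (tendsto_sumSq_cofinite.eventually (eventually_gt_atTop S))
  refine h.subset fun x hx => ?_
  simp only [Set.mem_setOf_eq, not_lt] at hx ⊢
  exact hx

/-- `M s^{-c} ≤ B` for all large `s` (`c > 0`, `B > 0`). [folklore] -/
theorem eventually_mul_rpow_neg_le {c : ℝ} (hc : 0 < c) (M : ℝ) {B : ℝ} (hB : 0 < B) :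
    ∀ᶠ s : ℝ in atTop, M * s ^ (-c) ≤ B := by
  have h : Tendsto (fun s : ℝ => M * s ^ (-c)) atTop (𝓝 (M * 0)) :=
    (tendsto_rpow_neg_atTop hc).const_mul M
  rw [mul_zero] at h
  exact h.eventually (eventually_le_nhds hB)

/-- A ratio bound on a finite set: for `F` finite there is `M > 0` with `f ≤ M g` at every point of
`F` where `g > 0`. [folklore] -/
theorem exists_le_mul_on_finite {F : Set (Site 3)} (hF : F.Finite) (f g : Site 3 → ℝ) :
    ∃ M : ℝ, 0 < M ∧ ∀ y ∈ F, 0 < g y → f y ≤ M * g y := by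
  classical
  refine ⟨1 + ∑ z ∈ hF.toFinset, max (f z / g z) 0, ?_, fun y hy hg => ?_⟩
  · have : 0 ≤ ∑ z ∈ hF.toFinset, max (f z / g z) 0 :=
      Finset.sum_nonneg fun z _ => le_max_right _ _
    linarith
  · have h1 : f y / g y ≤ ∑ z ∈ hF.toFinset, max (f z / g z) 0 :=
      (le_max_left _ _).trans (Finset.single_le_sum (f := fun z => max (f z / g z) 0)
        (fun z _ => le_max_right _ _) (hF.mem_toFinset.2 hy))
    rw [div_le_iff₀ hg] at h1
    nlinarith

/-- The outer boundary of the exterior region `E = {S₀ ≤ s}` (`S₀ ≥ 64`) lies in the shell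
`{S₀/4 ≤ s < S₀}`: a neighbour `y = x ± eᵢ` of `x ∈ E` has `s(y) = s(x) + (1 ± 2xᵢ) ≥ s(x)/4`.
[folklore] -/
theorem sumSq_of_mem_zdOuterBoundary {S₀ : ℝ} (hS : 64 ≤ S₀) {y : Site 3}
    (hy : y ∈ zdOuterBoundary {x : Site 3 | S₀ ≤ ∑ i, ((x i : ℤ) : ℝ) ^ 2}) :
    S₀ / 4 ≤ ∑ i, ((y i : ℤ) : ℝ) ^ 2 ∧ ∑ i, ((y i : ℤ) : ℝ) ^ 2 < S₀ := by
  obtain ⟨hyE, x, hx, i, hxy⟩ := hy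
  simp only [Set.mem_setOf_eq, not_le] at hyE hx
  refine ⟨?_, hyE⟩
  have h16 : (16 : ℝ) ≤ ∑ j, ((x j : ℤ) : ℝ) ^ 2 := by linarith
  obtain ⟨⟨h1, -⟩, h2, -⟩ := incr_bounds h16 (sq_apply_le_sumSq x i)
  rcases hxy with rfl | rfl
  · have hadd : (∑ j, (((x + Pi.single i 1 : Site 3) j : ℤ) : ℝ) ^ 2) =
        (∑ j, ((x j : ℤ) : ℝ) ^ 2) + (2 * ((x i : ℤ) : ℝ) + 1) := by
      fin_cases i <;> simp [Fin.sum_univ_three] <;> ring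
    rw [hadd]; linarith
  · have hsub : (∑ j, (((x - Pi.single i 1 : Site 3) j : ℤ) : ℝ) ^ 2) =
        (∑ j, ((x j : ℤ) : ℝ) ^ 2) + (1 - 2 * ((x i : ℤ) : ℝ)) := by
      fin_cases i <;> simp [Fin.sum_univ_three] <;> ring
    rw [hsub]; linarith

/-- Norm exchange on `ℤ³ ∖ {0}`: `‖x‖⁻¹ ≤ √3 · s(x)^{-1/2}` (from `s ≤ 3‖x‖²`). [folklore] -/
theorem inv_norm_le_sqrt_three_mul_rpow {x : Site 3} (hx : x ≠ 0) :
    ‖x‖⁻¹ ≤ Real.sqrt 3 * (∑ i, ((x i : ℤ) : ℝ) ^ 2) ^ (-(1 / 2 : ℝ)) := by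
  have hn : 0 < ‖x‖ := PerfectScreening.norm_pos_of_ne_zero hx
  have hS1 : (1 : ℝ) ≤ ∑ i, ((x i : ℤ) : ℝ) ^ 2 := PerfectScreening.one_le_sum_sq hx
  have hS0 : (0 : ℝ) < ∑ i, ((x i : ℤ) : ℝ) ^ 2 := by linarith
  have hS3 : ∑ i, ((x i : ℤ) : ℝ) ^ 2 ≤ 3 * ‖x‖ ^ 2 := PerfectScreening.sum_sq_le_three_mul_norm_sq x
  have e2 : (∑ i, ((x i : ℤ) : ℝ) ^ 2) ^ (-(1 / 2 : ℝ)) = (Real.sqrt (∑ i, ((x i : ℤ) : ℝ) ^ 2))⁻¹ := by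
    rw [Real.rpow_neg hS0.le, Real.sqrt_eq_rpow]
  have hsq : Real.sqrt (∑ i, ((x i : ℤ) : ℝ) ^ 2) ≤ Real.sqrt 3 * ‖x‖ := by
    rw [← Real.sqrt_sq hn.le, ← Real.sqrt_mul (by norm_num : (0 : ℝ) ≤ 3)]
    exact Real.sqrt_le_sqrt hS3
  have h3 : 0 < Real.sqrt 3 := Real.sqrt_pos.2 (by norm_num)
  rw [e2]
  calc ‖x‖⁻¹ = Real.sqrt 3 * (Real.sqrt 3 * ‖x‖)⁻¹ := by field_simp
    _ ≤ Real.sqrt 3 * (Real.sqrt (∑ i, ((x i : ℤ) : ℝ) ^ 2))⁻¹ :=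
        mul_le_mul_of_nonneg_left (inv_anti₀ (Real.sqrt_pos.2 hS0) hsq) h3.le

/-! ### Linearity of `Δ` in lambda form -/

/-- The Laplacian of `f - A g` and of `f + A g` (linearity, in the lambda form used below). [folklore] -/
theorem latticeLaplacianZd_sub_const_mul (f g : Site 3 → ℝ) (A : ℝ) (x : Site 3) :
    latticeLaplacianZd (fun y => f y - A * g y) x =
        latticeLaplacianZd f x - A * latticeLaplacianZd g x ∧
      latticeLaplacianZd (fun y => f y + A * g y) x =
        latticeLaplacianZd f x + A * latticeLaplacianZd g x := by
  constructor
  · rw [show (fun y => f y - A * g y) = f - fun y => A * g y from rfl, latticeLaplacianZd_sub,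
      latticeLaplacianZd_const_mul]
  · rw [show (fun y => f y + A * g y) = f + fun y => A * g y from rfl, latticeLaplacianZd_add,
      latticeLaplacianZd_const_mul]

end Summit.CriticalPhenomena.Ising3DConformalLimit.Theorems.EtaBoundsFromTelemetry
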